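import Summits.QuantumFields.YangMills.Theorems.BalabanUVNodesN07Prop8StepTokenOfRecordSym152GClosed
import Summits.QuantumFields.YangMills.Theorems.BalabanUVNodesN07Prop8StepCoPGridGOfPremises
import HarnessLib

/-!
# N07 [B11] (= [15] = [Balaban1985Variational]) Sect. F — **MODULE 125 = EDITION 120-G: K0⁷ V22-Z STUB 1's TEXT `Prop8StepCoPGridGAt F` FROM TWO DISPLAYED PREMISES, BY NAME — GUARD
# EDITION** — ✓p750951 ∕ ✓p751455's `…N07Prop8StepCoPGridGOfPremises` (120, the landed original this file is a TWIN of — №314 (g-1): token substitution only; statement shape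
# identical but for ONE outer `∃ md` naming the dent modulus; no new displayed hypothesis) with (P1) ∕ (P1′) read at the GUARD EDITION (c-ii)‴ `HThm4RecSym152PhiEG F 2 Mc (ρ₀·L) (F.L ^ md)
# κ a₀ Ψ` (MODULE 121; candidate (β′), plan g94 WORD (B) 2026-08-30, transition armed) — the K0 witness pays the new datum row FROM THE REGISTERED GUARD: block height `a′ := M_h⁰ + md`
# (so `L^md ∣ L·M_h = L^{c₁}`), guard conjuncts 3–4 (`F.L ^ c₁ ∣ M`, the torus-period row) ⇒ `hAdm₂` ⇒ the row; composition through MODULE 124; §1 of 120 imported by name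

Cell `pub-ymgap`, seat `pub-ymgap-dag-n07-e` g32 (FAN-OUT §N07 row s3; LANE OWNER of the K0 road chart side).  `--kind proof --supports stmt-QuantumFields-20541 --as helper` (K0⁷);
count-neutral; TWO theorems (0 `def`).  [15] = [Balaban1985Variational]; [6] = [Balaban1985RegularSpaces]; [3] = [Balaban1985Averaging]; [I] = [Balaban1987RG1]; [III] = [Balaban1988Convergent].

WHY (dag-n07-w3 g13 ⚑ LOCATED-TOP-DENT ∕ Q2′; n07-e g32 ANSWER, pub-ymgap bus 2026-08-30 00:02Z).  The φ-junction proves the Thm-4 record structure at the print datum DENTED at the top by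
`Ω_j` ([15] (150)); n05-e's crown engine needs the dent saturated for `L^{s+1}·Lʲ`-superblocks, i.e. `L^{s+1} ∣ M·R_j` + the torus period `Lʲ·M·R_j ∣ sitesPerDir 0` — in print
standing hypotheses (`M = L^m` [I] §1 p. 257, `R_j = L^{r_j}` [III] (2.5) p. 255, torus `L_μ = L^m` [I] (0.1) p. 251; pub-ymgap RR-2 WORD-30), in the tree the REGISTERED K0 guard
`A‴(c, c₀, c₁)` of V22-Z stub 1 (conjuncts 3–4).  The def of record (β) binds `M` bare, so the junction cannot serve it; the guard edition (c-ii)‴ displays the two letters at the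
datum (modulus `Md`), the K0 chain's `hAdm₂` discharges them (MODULES 121–124), and THIS FILE chooses `c₁ := M_h⁰ + md + 1 ≥ md` so that the junction's modulus `L^md` (its
`md := s + 1`) divides the chain's `L·M_h`.  Net: the lane's debt toward stub 1 is again DISPLAYED AS TWO NAMED PREMISES and nothing else —
(P1-G) `∃ md ρmin Aκ, 1 ≤ ρmin ∧ 0 ≤ Aκ ∧ ∀ ρ₀, ρmin ∣ ρ₀ → 1 ≤ ρ₀ → ∃ κ a₀ ψc, 0 < κ ∧ κ ≤ Aκ·ρ₀ ∧ 0 < a₀ ∧ 0 ≤ ψc ∧ HThm4RecSym152PhiEG F 2 Mc (ρ₀·L) (F.L ^ md) κ a₀ (ψc·(κ·ε j)²)`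
     (the collar-uniform shape of the junction's export, now with its dent exponent `md` outermost; CONDITIONAL — N05's (B′) road + n07-w3's knit);
(P2) HSEAM for every step guard (R4; the (ii)-docket) — 100⁵'s text at `N := 2`, unchanged.
§3: (P1′-G) = (P1-G) at the print letters `κ := b9OfP`, `a₀ := a0OfP` (120 v1.1 §3's shape + `∃ md`).

WHAT IS PROVED (sorry-free; axioms standard).
§2 ★★★ `prop8StepCoPGridGAt_of_sym152PhiEG_uniform_of_seam (F) (Mc) (hMc : 1 ≤ Mc) (hTU : (P1-G)) (hseam : (P2)) : K0V22ZDefs.Prop8StepCoPGridGAt F` — integers: `a′ := M_h⁰ + md`,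
   `M_h := L^{a′}`, `R := R₀ + 2`, `ρ₀ := ρmin·M_h·t` with `t := ρth + R + Mc + 1`, `ρ := ρ₀·L`, `c := (11·4 + 4ρ + Mc + 3)·L`, `c₀ := Mc + 11·4 + 6ρ + 1 + F.m + a′ + 3`,
   `c₁ := a′ + 1`; then MODULE 124 at `a_max := a₀(P1-G)` and `hThm4RecSym152PhiEG_mono` (a₀ down, modulus `L^md ∣ L·M_h` up); 120 §1 `collar_letter_eventually_linear` by name.
§3 ★★ `prop8StepCoPGridGAt_of_sym152PhiEG_printLetters_of_seam` — (P1′-G) ⇒ (P1-G) by 120 §3 `b9OfP_le_linear`, `a0OfP_pos`.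
HONEST LABEL (binding).  Count-neutral composition + integer bookkeeping; (P1-G) is CONDITIONAL (N05's (B′) road + the φ-junction's knit, open (σ1)(σ2); (σ3) is now READ OFF the
datum) and (P2) is a displayed HYPOTHESIS ((ii)-docket: under the tree's inclusive `B15DeterminingSets.bondsOf` reading NOT derivable — the converse direction is 37a
`…N07CritMultiScaleLamBond.isCritOnFibre_genSet_of_critLam`); nothing of [15]∕[6]∕[3] ANALYSIS asserted beyond the cited modules; NO stub registered or closed HERE (stub 1 closes
only when (P1-G) and (P2) are theorems); (β) #10883 stays the def OF RECORD until the custodian's (1)–(4); K0⁷ ∕ K1⁹ NOT closed; N07 NOT discharged and NOT claimable; counts unmoved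
(typed 28∕28 · discharged 8∕28); one finite 𝕋⁴ programme at fixed ε — the route closes the conditional finite-𝕋⁴ rung `BalabanLadder.UV` ONLY; the YM mass gap (Clay) is NOT proved
by any of this; nothing continuum ∕ ℝ⁴ ∕ OS.  No `def`, no `instance`, no `notation`, no `sorry`.

References: [15] Prop. 8 p. 304, (144) p. 300, (147)–(163) pp. 301–304; [6] Thm. 4 p. 88, Prop. 6 (1.130)–(1.138) p. 99, p. 98; [3] (26) p. 22, (78)–(81) p. 30; [I] (0.1) p. 251,
§1 p. 257, (0.4), (0.11) p. 253; [III] (2.1) p. 254, (2.5) p. 255.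
-/

set_option autoImplicit false

noncomputable section

open scoped BigOperators Matrix.Norms.L2Operator

namespace Summit.QuantumFields.YangMills.BalabanUVNodes.N07Prop8StepCoPGridGOfPremisesG

open Literature.MathematicalPhysics.QuantumFieldTheory.Balaban1983to89
open Literature.MathematicalPhysics.QuantumFieldTheory.Balaban1983to89.Node00
open Literature.MathematicalPhysics.QuantumFieldTheory.Balaban1983to89.B15DeterminingSets
open T4Continuum (T4Family)
open GaugeField (gaugeAct)
open Summit.QuantumFields.YangMills.BalabanUVNodes.N07Thm4RecordStructureSym152PhiEG (HThm4RecSym152PhiEG hThm4RecSym152PhiEG_mono)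
open Summit.QuantumFields.YangMills.BalabanUVNodes.N07Prop8StepTokenOfRecordSym152GClosed (prop8RegSepTopStepG_of_hThm4RecSym152PhiEG_closed)
open Summit.QuantumFields.YangMills.BalabanUVNodes.N07Prop8StepCoPGridGOfPremises (collar_letter_eventually_linear b9OfP_le_linear)
open Summit.QuantumFields.YangMills.Theorems.K0V22ZDefs (Prop8StepCoPGridGAt)

variable (F : T4Family)

/-! ## §1  (= 120 §1, imported by name: `collar_letter_eventually_linear`) -/

/-! ## §2  V22-Z stub 1's text from (P1-G) and (P2) -/

set_option maxHeartbeats 1600000 in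
open scoped Classical in
/-- ★★★ **K0⁷ V22-Z STUB 1's TEXT FROM THE TWO DISPLAYED PREMISES — GUARD EDITION** (twin of ✓p750951's `prop8StepCoPGridGAt_of_sym152PhiE_uniform_of_seam`: (P1) read at (c-ii)‴ with
its dent exponent `md` outermost; K0 witness `a′ := M_h⁰ + md`; composition through MODULE 124; every other byte identical): for a grid side `Mc ≥ 1`, the collar-uniform conditional
premise (P1-G) (row 9′ = N05's (B′) road at the dented datum) and HSEAM (P2) for every step guard give `Prop8StepCoPGridGAt F` — the K0 witness's integers, `B₃ a₀ a₁`, the collar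
letter AND the premise's grid row are chosen ∕ discharged inside (MODULES 118, 124, 120 §1; the grid row from guard conjuncts 3–4 via `hAdm₂`, `L^md ∣ L·M_h`).
[cite: Balaban1985Variational, Prop. 8 p.304, (144) p.300, (147)–(163) pp.301–304; Balaban1985RegularSpaces, Thm. 4 p.88, Prop. 6 (1.130)–(1.138) p.99, p.98; Balaban1985Averaging, (26) p.22, (78)–(81) p.30; Balaban1987RG1, (0.1) p.251, p.257, (0.4), (0.11) p.253; Balaban1988Convergent, (2.5) p.255] -/
theorem prop8StepCoPGridGAt_of_sym152PhiEG_uniform_of_seam (Mc : ℕ) (hMc : 1 ≤ Mc)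
    -- ★ (P1-G) THE CONDITIONAL PREMISE, COLLAR-UNIFORM, GUARD EDITION ((c-ii)‴ at modulus `L^md`; N05's (B′) road ∕ n07-w3's junction at the dented datum)
    (hTU : ∃ md ρmin : ℕ, ∃ Aκ : ℝ, 1 ≤ ρmin ∧ 0 ≤ Aκ ∧ ∀ ρ₀ : ℕ, ρmin ∣ ρ₀ → 1 ≤ ρ₀ →
      ∃ κ a₀ ψc : ℝ, 0 < κ ∧ κ ≤ Aκ * (ρ₀ : ℝ) ∧ 0 < a₀ ∧ 0 ≤ ψc ∧ HThm4RecSym152PhiEG F 2 Mc (ρ₀ * F.L) (F.L ^ md) κ a₀ (fun ε j => ψc * (κ * ε j) ^ 2))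
    -- ★ (P2) HSEAM = (R4) for every step guard — displayed, NOT discharged
    (hseam : ∀ (Adm : StepGuard F), ∀ (ν : Stage7Numerics) (M : ℕ) (g : ℕ → ℝ) (K k : ℕ) (s : SeqOfRecord F ν M g K k), Sect2.SeqSeparated ν.M₁ s → 0 < ν.M₁ →
        Adm ν M g K k s → 1 ≤ k →
        ∀ (δ : ℕ → ℝ),
        ∀ W : MSField (F.P K) (SU 2), Sect2.DataSmall7PTop (avOfRecord F 2 K) s.Ω (suppDomOfRecord F ν K s.Ω) k δ W →
        ∀ U : GaugeField (F.P K) 0 (SU 2),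
        AgreeOn (genSet s.Ω k) (avgFamily (avOfRecord F 2 K) U) W → IsCritOnFibre F 2 K (genSet s.Ω k) W U →
        ∀ (hkk : k ≤ (F.P K).m + (F.P K).K),
        ∀ γ : ℝ → GaugeField (F.P K) 0 (SU 2), γ 0 = U →
          DifferentiableAt ℝ (fun (t : ℝ) (b : PBond (F.P K) 0) => ((γ t b : SU 2) : Matrix (Fin 2) (Fin 2) ℂ)) 0 →
            (∀ᶠ t in nhds (0 : ℝ), ∀ (j : ℕ) (c : PBond (F.P K) j), (domainsOfSeq s.Ω k hkk).LamBond j c →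
              avgFamily (avOfRecord F 2 K) (γ t) j c = W j c) →
              ∀ a : ℝ, HasDerivAt (fun t => wilsonAction4 (γ t)) a 0 → a = 0)
    : Prop8StepCoPGridGAt F := by
  obtain ⟨Mh₀, R₀, CH, δH, BH, hCH, hδH, hBH, hhead⟩ := prop8RegSepTopStepG_of_hThm4RecSym152PhiEG_closed F 2
  obtain ⟨md, ρmin, Aκ, hρmin, hAκ, hU⟩ := hTU
  obtain ⟨ρth, hth⟩ := collar_letter_eventually_linear F Mc hCH hBH.le hδH hAκ
  have hL1 : 1 ≤ F.L := (F.P 0).L_pos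
  have hL2 : 2 ≤ F.L := by have := F.hL11; omega
  -- the K0 witness's integers
  set a' : ℕ := Mh₀ + md with ha'
  set Mh : ℕ := F.L ^ a' with hMh
  have hMh₀ : Mh₀ ≤ Mh :=
    calc Mh₀ ≤ Mh₀ + md := Nat.le_add_right _ _
      _ ≤ F.L ^ (Mh₀ + md) := (Nat.lt_pow_self (by omega : 1 < F.L)).le
      _ = Mh := by rw [hMh]
  -- the junction's dent modulus divides the chain's: `L^md ∣ L·M_h = L^{a′+1}`
  have hmdMh : F.L ^ md ∣ F.L * Mh := by
    rw [hMh, ha', ← pow_succ']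
    exact pow_dvd_pow F.L (by omega)
  have hMh1 : 1 ≤ Mh := Nat.one_le_pow _ _ (by omega)
  set R : ℕ := R₀ + 2 with hR
  set t : ℕ := ρth + R + Mc + 1 with ht
  set ρ₀ : ℕ := ρmin * Mh * t with hρ₀
  have ht1 : 1 ≤ t := by omega
  have hρ₀1 : 1 ≤ ρ₀ := by
    rw [hρ₀]; exact Nat.one_le_iff_ne_zero.mpr (by positivity)
  have hρ₀t : t ≤ ρ₀ := by
    rw [hρ₀]; exact Nat.le_mul_of_pos_left t (by positivity)
  have hρ₀d : ρmin ∣ ρ₀ := ⟨Mh * t, by rw [hρ₀]; ring⟩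
  set ρ : ℕ := ρ₀ * F.L with hρ
  have hρt : t ≤ ρ := hρ₀t.trans (Nat.le_mul_of_pos_right ρ₀ (by omega))
  have hMcρ : Mc ≤ ρ := by omega
  have hLρ : F.L ≤ ρ := by rw [hρ]; exact Nat.le_mul_of_pos_left F.L (by omega)
  have hdvd : F.L * Mh ∣ ρ := ⟨ρmin * t, by rw [hρ, hρ₀]; ring⟩
  have hRρ : R * (F.L * Mh) ≤ ρ := by
    have h1 : R ≤ ρmin * t :=
      calc R ≤ t := by omega
        _ = 1 * t := (one_mul t).symm
        _ ≤ ρmin * t := Nat.mul_le_mul_right t hρmin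
    calc R * (F.L * Mh) ≤ (ρmin * t) * (F.L * Mh) := Nat.mul_le_mul_right _ h1
      _ = ρ := by rw [hρ, hρ₀]; ring
  have hRM : 2 * F.L ≤ R * (F.L * Mh) + 1 := by
    have h1 : 2 * F.L ≤ R * (F.L * Mh) := by
      calc 2 * F.L = 2 * (F.L * 1) := by ring
        _ ≤ R * (F.L * Mh) := Nat.mul_le_mul (by omega) (Nat.mul_le_mul_left _ hMh1)
    omega
  set c : ℕ := (11 * 4 + 4 * ρ + Mc + 3) * F.L with hc
  set c₀ : ℕ := Mc + 11 * 4 + 6 * ρ + 1 + F.m + a' + 3 with hc₀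
  have hc₀row : Mc + 11 * 4 + 6 * ρ + 1 ≤ 2 * F.L ^ c₀ := by
    have h1 : c₀ ≤ F.L ^ c₀ := (Nat.lt_pow_self (by omega : 1 < F.L)).le
    omega
  have hmc₀ : F.m ≤ c₀ := by omega
  have hac₀ : a' + 3 ≤ c₀ := by omega
  set c₁ : ℕ := a' + 1 with hc₁
  -- the grid guard of the registered text
  set Adm : StepGuard F := fun ν M g K k _s => c ≤ ν.M₁ ∧ k + c₀ ≤ F.m + K ∧ F.L ^ c₁ ∣ M ∧
      ∀ i, 1 ≤ i → i ≤ k → dCubeSide (F.P K).L M (RkOfRecord (F.P K).L ν.r (g i)) i ∣ (F.P K).sitesPerDir 0 with hAdm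
  have hAdm₁ : ∀ (ν : Stage7Numerics) (M : ℕ) (g : ℕ → ℝ) (K k : ℕ) (s : SeqOfRecord F ν M g K k), Adm ν M g K k s → c ≤ ν.M₁ ∧ k + c₀ ≤ F.m + K :=
    fun ν M g K k s h => ⟨h.1, h.2.1⟩
  have hAdm₂ : ∀ (ν : Stage7Numerics) (M : ℕ) (g : ℕ → ℝ) (K k : ℕ) (s : SeqOfRecord F ν M g K k), Adm ν M g K k s → ∀ j : ℕ, 1 ≤ j → j ≤ k →
      F.L * Mh ∣ M * RkOfRecord (F.P K).L ν.r (g j) ∧ dCubeSide (F.P K).L M (RkOfRecord (F.P K).L ν.r (g j)) j ∣ (F.P K).sitesPerDir 0 := by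
    intro ν M g K k s h j hj1 hjk
    refine ⟨?_, h.2.2.2 j hj1 hjk⟩
    have h1 : F.L * Mh = F.L ^ c₁ := by rw [hMh, hc₁, pow_succ]; ring
    rw [h1]
    exact Dvd.dvd.mul_right h.2.2.1 _
  -- (P1) at the chosen collar; the collar letter
  obtain ⟨κ, amax, ψc, hκ, hκA, hamax, hψc, hT0⟩ := hU ρ₀ hρ₀d hρ₀1
  have hcollar : 32 * ((sideP (F.P 0) Mc ρ : ℕ) : ℝ) * CH * BH * Real.exp (-(δH * (ρ : ℝ))) * (κ * (F.L : ℝ)) ≤ 1 :=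
    hth ρ₀ (by omega) κ hκ.le hκA
  -- the closed head
  obtain ⟨a₀, ha₀, ha₀max, hrest⟩ :=
    hhead (ρ := ρ) (Mc := Mc) (Mh := Mh) (R := R) (a' := a') hMc hMcρ hMh hMh₀ (by omega) hdvd hRρ hLρ hRM (c := c) (c₀ := c₀) le_rfl hc₀row hmc₀ hac₀ Adm hAdm₁ hAdm₂
      hκ hψc hamax hcollar
  have hT : HThm4RecSym152PhiEG F 2 Mc ρ (F.L * Mh) κ a₀ (fun ε j => ψc * (κ * ε j) ^ 2) :=
    hThm4RecSym152PhiEG_mono hκ le_rfl ha₀max (fun _ _ => le_rfl) hmdMh hT0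
  obtain ⟨B₃, a₁, hB₃L, ha₁, htok⟩ := hrest hT (hseam Adm)
  unfold Prop8StepCoPGridGAt
  exact ⟨c, c₀, c₁, B₃, a₀, a₁, hB₃L, ha₀, ha₁, htok⟩


/-! ## §3  (P1′-G): (P1-G) AT THE PRINT LETTERS `b9OfP ∕ a0OfP` — the junction's own export shape (120 v1.1 §3 + `∃ md`; `b9OfP_le_linear` imported by name) -/

set_option maxHeartbeats 800000 in
open scoped Classical in
/-- ★★ **V22-Z STUB 1's TEXT FROM (P1′-G) AT THE PRINT LETTERS** (twin of ✓p751455's `prop8StepCoPGridGAt_of_sym152PhiE_printLetters_of_seam` + `∃ md`): the §2 theorem with (P1-G) in the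
export shape of n07-w3's junction — ONE `(md, ρmin, B₁, c₁′, ψc)`, `κ := b9OfP F Mc (ρ₀·L) B₁`, `a₀ := a0OfP F 2 Mc (ρ₀·L) B₁ c₁′`, `Ψ ε j := ψc·(κ·ε_j)²`, modulus `L^md`, at every
collar `ρ₀ ∈ ρmin·ℕ` — and HSEAM (P2).  `κ ≤ Aκ·ρ₀` by 120 §3 `b9OfP_le_linear`, `0 < a₀` by `a0OfP_pos`.
[cite: Balaban1985Variational, Prop. 8 p.304, (152) p.301, (163) p.304; Balaban1985RegularSpaces, Prop. 6 (1.130)–(1.138) p.99; Balaban1987RG1, (0.4), (0.11) p.253; Balaban1988Convergent, (2.5) p.255] -/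
theorem prop8StepCoPGridGAt_of_sym152PhiEG_printLetters_of_seam (Mc : ℕ) (hMc : 1 ≤ Mc)
    -- ★ (P1′-G) THE CONDITIONAL PREMISE AT THE PRINT LETTERS, GUARD EDITION ((c-ii)‴ at modulus `L^md`; N05's (B′) road ∕ n07-w3's junction)
    (hTP : ∃ md ρmin : ℕ, ∃ B₁ c₁ ψc : ℝ, 1 ≤ ρmin ∧ 0 ≤ B₁ ∧ 0 < c₁ ∧ 0 ≤ ψc ∧ ∀ ρ₀ : ℕ, ρmin ∣ ρ₀ → 1 ≤ ρ₀ →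
      HThm4RecSym152PhiEG F 2 Mc (ρ₀ * F.L) (F.L ^ md) (b9OfP F Mc (ρ₀ * F.L) B₁) (a0OfP F 2 Mc (ρ₀ * F.L) B₁ c₁)
        (fun ε j => ψc * (b9OfP F Mc (ρ₀ * F.L) B₁ * ε j) ^ 2))
    -- ★ (P2) HSEAM = (R4) for every step guard — displayed, NOT discharged
    (hseam : ∀ (Adm : StepGuard F), ∀ (ν : Stage7Numerics) (M : ℕ) (g : ℕ → ℝ) (K k : ℕ) (s : SeqOfRecord F ν M g K k), Sect2.SeqSeparated ν.M₁ s → 0 < ν.M₁ →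
        Adm ν M g K k s → 1 ≤ k →
        ∀ (δ : ℕ → ℝ),
        ∀ W : MSField (F.P K) (SU 2), Sect2.DataSmall7PTop (avOfRecord F 2 K) s.Ω (suppDomOfRecord F ν K s.Ω) k δ W →
        ∀ U : GaugeField (F.P K) 0 (SU 2),
        AgreeOn (genSet s.Ω k) (avgFamily (avOfRecord F 2 K) U) W → IsCritOnFibre F 2 K (genSet s.Ω k) W U →
        ∀ (hkk : k ≤ (F.P K).m + (F.P K).K),
        ∀ γ : ℝ → GaugeField (F.P K) 0 (SU 2), γ 0 = U →
          DifferentiableAt ℝ (fun (t : ℝ) (b : PBond (F.P K) 0) => ((γ t b : SU 2) : Matrix (Fin 2) (Fin 2) ℂ)) 0 →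
            (∀ᶠ t in nhds (0 : ℝ), ∀ (j : ℕ) (c : PBond (F.P K) j), (domainsOfSeq s.Ω k hkk).LamBond j c →
              avgFamily (avOfRecord F 2 K) (γ t) j c = W j c) →
              ∀ a : ℝ, HasDerivAt (fun t => wilsonAction4 (γ t)) a 0 → a = 0)
    : Prop8StepCoPGridGAt F := by
  obtain ⟨md, ρmin, B₁, c₁, ψc, hρmin, hB₁, hc₁, hψc, h⟩ := hTP
  refine prop8StepCoPGridGAt_of_sym152PhiEG_uniform_of_seam F Mc hMc
    ⟨md, ρmin, 112 * (F.L : ℝ) ^ 5 * B₁ * ((F.L : ℝ) * Mc + 44 + 2 * (F.L : ℝ)) + 1, hρmin, by positivity, fun ρ₀ hd h1 => ?_⟩ hseam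
  refine ⟨b9OfP F Mc (ρ₀ * F.L) B₁, a0OfP F 2 Mc (ρ₀ * F.L) B₁ c₁, ψc, ?_, b9OfP_le_linear F Mc hB₁ h1, a0OfP_pos Mc (ρ₀ * F.L) hB₁ hc₁, hψc, h ρ₀ hd h1⟩
  unfold b9OfP
  have hL0 : (0 : ℝ) ≤ F.L := Nat.cast_nonneg _
  positivity

end Summit.QuantumFields.YangMills.BalabanUVNodes.N07Prop8StepCoPGridGOfPremisesG

end
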